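import Literature.Topology.FourManifolds.SignatureAdditivityAlgebra
import Literature.Topology.FourManifolds.BoundarySignature
import Literature.AlgebraicTopology.SingularHomology.IntersectionForm
import Literature.AlgebraicTopology.SingularHomology.CupProductProofs
import Literature.AlgebraicTopology.SingularHomology.CupProductSupports
import HarnessLib

/-!
# Additivity of the signature from two collapse maps (cohomological form)

M. Kervaire, J. Milnor, *Groups of homotopy spheres I*, Ann. of Math. 77 (1963), §2 p. 508:
the boundary connected sum "clearly has signature `σ(M) = σ(M₁) + σ(M₂)`". The cohomological
mechanism, isolated here for three `ℤ`-oriented spaces `X_U`, `X_S`, `X_T` of formal dimension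
`n = k + k` (`k` even) and two maps `π_S : X_U → X_S`, `π_T : X_U → X_T` ("collapse the other
summand"):

* `π_S`, `π_T` carry the fundamental class of `X_U` to those of `X_S`, `X_T` — so they are
  isometric for the cup product pairings (naturality of `⌣`, Hatcher 2002 Prop. 3.10, and of the
  Kronecker pairing, §3.1 p. 201);
* on an open cover `X_U = U ∪ V`, `π_S^*` vanishes on `U` and `π_T^*` vanishes on `V` — so the
  cross terms `π_S^* a ⌣ π_T^* b` vanish (cup product with supports, Hatcher §3.2 p. 209,
  `map_cupProduct_eq_zero_of_isOpen`);
* for two further subsets `A`, `B` (in the application the two open copies of the interiors of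
  the summands, which do not cover), `(π_S|_A)^*`, `(π_T|_B)^*` are bijective on `Hᵏ`,
  `(π_T|_A)^* = 0 = (π_S|_B)^*`, and the two restrictions are jointly injective on `Hᵏ(X_U)`
  (Mayer–Vietoris twice) — so `π_S^* ⊕ π_T^*` is bijective modulo torsion
  (`LinearMap.BilinForm.signature_eq_add_of_embeddings`).

Then `σ(X_U) = σ(X_S) + σ(X_T)` (`HomologicalOrientation.signatureInDim_eq_add_of_collapse`).
No manifold hypothesis enters: the geometric input (the closed models of `W₁ ♮ W₂` and the
collapses) discharges the hypotheses elsewhere. Everything is proved; no named facts.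

## References

* M. A. Kervaire, J. W. Milnor, *Groups of homotopy spheres: I*, Ann. of Math. (2) 77 (1963),
  §2 p. 508. [KervaireMilnorAnnals1963]
* A. Hatcher, *Algebraic Topology*, CUP 2002, Prop. 3.10, §3.1 p. 201, §3.2 p. 209, §3.3 p. 250.
  [HatcherAT2002]
-/

noncomputable section

open CategoryTheory Set Function
open Literature.AlgebraicTopology.SingularHomology

universe u v

namespace Literature.AlgebraicTopology.SingularHomology

variable {X Y : Type u} [TopologicalSpace X] [TopologicalSpace Y] {k : ℕ}

/-! ### Cohomology modulo torsion: injectivity and bijectivity transfer -/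

namespace freeCohomology

/-- `(r s) • x = r • (s • x)` for non-zero-divisors acting on a module. [folklore] -/
theorem nonZeroDivisors_mul_smul {R : Type v} [CommRing R] {M : Type*} [AddCommGroup M]
    [Module R M] (r s : nonZeroDivisors R) (x : M) : (r * s) • x = (r : R) • ((s : R) • x) := by
  rw [Submonoid.smul_def, Submonoid.coe_mul, mul_smul]

/-- Linear maps commute with two scalars (generic in `R`). [folklore] -/
theorem map_smul_smul {R : Type v} [CommRing R] {M N : Type*} [AddCommGroup M]
    [AddCommGroup N] [Module R M] [Module R N] (f : M →ₗ[R] N) (a b : R) (x : M) :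
    f (a • b • x) = a • b • f x := by
  rw [LinearMap.map_smul, LinearMap.map_smul]

/-- A class whose image modulo torsion vanishes is killed by a non-zero-divisor. [folklore] -/
theorem exists_smul_eq_zero_of_mk_eq_zero {R : Type v} [CommRing R] {X : Type u} [TopologicalSpace X]
    {k : ℕ} {a : singularCohomology R R X k} (h : (mk a : freeCohomology R X k) = 0) :
    ∃ r : nonZeroDivisors R, (r : R) • a = 0 := by
  rw [mk_eq_zero_iff] at h
  obtain ⟨r, hr⟩ := (Submodule.mem_torsion_iff a).1 h
  exact ⟨r, by rw [← Submonoid.smul_def]; exact hr⟩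

/-- **A bijection on cohomology induces a bijection modulo torsion.** [folklore] -/
theorem map_bijective_of_bijective (f : C(X, Y)) (k : ℕ)
    (hf : Bijective (singularCohomology.map ℤ ℤ f k)) : Bijective (map (R := ℤ) f k) := by
  constructor
  · rw [injective_iff_map_eq_zero]
    intro x hx
    induction x using freeCohomology.induction_on with
    | h a =>
      rw [map_mk] at hx
      obtain ⟨r, hr⟩ := exists_smul_eq_zero_of_mk_eq_zero hx
      rw [mk_eq_zero_iff, Submodule.mem_torsion_iff]
      refine ⟨r, hf.1 ?_⟩
      rw [map_zero]
      exact (LinearMap.map_smul _ (r : ℤ) a).trans hr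
  · intro y
    induction y using freeCohomology.induction_on with
    | h b =>
      obtain ⟨a, ha⟩ := hf.2 b
      exact ⟨mk a, by rw [map_mk, ha]⟩

/-- **Joint injectivity of two restrictions passes to cohomology modulo torsion.** [folklore] -/
theorem eq_zero_of_map_eq_zero₂ {Z : Type u} [TopologicalSpace Z] (f : C(Y, X)) (g : C(Z, X)) (k : ℕ)
    (hinj : ∀ c : singularCohomology ℤ ℤ X k,
      singularCohomology.map ℤ ℤ f k c = 0 → singularCohomology.map ℤ ℤ g k c = 0 → c = 0)
    (w : freeCohomology ℤ X k) (hf : map f k w = 0) (hg : map g k w = 0) : w = 0 := by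
  induction w using freeCohomology.induction_on with
  | h c =>
    rw [map_mk] at hf hg
    obtain ⟨r, hr⟩ := exists_smul_eq_zero_of_mk_eq_zero hf
    obtain ⟨s, hs⟩ := exists_smul_eq_zero_of_mk_eq_zero hg
    rw [mk_eq_zero_iff, Submodule.mem_torsion_iff]
    refine ⟨s * r, hinj _ ?_ ?_⟩
    · rw [nonZeroDivisors_mul_smul, map_smul_smul, hr, smul_zero]
    · rw [mul_comm, nonZeroDivisors_mul_smul, map_smul_smul, hs, smul_zero]

end freeCohomology

/-! ### Cup products of classes pulled back along maps vanishing on a cover -/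

/-- `subsetIncl univ` is (the coercion of) the homeomorphism `univ ≃ X`, hence induces an injective
map on cohomology. [folklore] -/
theorem singularCohomology.map_subsetIncl_univ_injective (R : Type v) [CommRing R] (X : Type u)
    [TopologicalSpace X] (n : ℕ) :
    Injective (singularCohomology.map R R (subsetIncl (univ : Set X)) n) := by
  have he : ((Homeomorph.Set.univ X : ↥(univ : Set X) ≃ₜ X) : C(↥(univ : Set X), X)) =
      subsetIncl (univ : Set X) := rfl
  rw [← he]
  exact ((forget (ModuleCat R)).mapIso
    (singularCohomology.mapIso R R (Homeomorph.Set.univ X) n)).toEquiv.injective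

/-- **Cross terms vanish**: if `f^*` kills the restriction to the open `U` (`(f ∘ incl_U)^* = 0`
in degree `p`) and `g^*` kills the restriction to the open `V` in degree `q`, `U ∪ V = X`, then
`f^* a ⌣ g^* b = 0` (Hatcher 2002, §3.2 p. 209, cup product with supports).
[cite: HatcherAT2002, §3.2 p. 209] -/
theorem cupProduct_map_map_eq_zero {XS XT : Type u} [TopologicalSpace XS] [TopologicalSpace XT]
    {U V : Set X} (hU : IsOpen U) (hV : IsOpen V) (hUV : U ∪ V = univ) {p q n : ℕ} (h : p + q = n)
    (f : C(X, XS)) (g : C(X, XT))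
    (hf : singularCohomology.map ℤ ℤ (f.comp (subsetIncl U)) p = 0)
    (hg : singularCohomology.map ℤ ℤ (g.comp (subsetIncl V)) q = 0)
    (a : singularCohomology ℤ ℤ XS p) (b : singularCohomology ℤ ℤ XT q) :
    cupProduct h (singularCohomology.map ℤ ℤ f p a) (singularCohomology.map ℤ ℤ g q b) = 0 := by
  apply singularCohomology.map_subsetIncl_univ_injective ℤ X n
  rw [map_zero]
  refine map_cupProduct_eq_zero_of_isOpen hU hV h ?_ ?_ (S := univ) (by rw [hUV])
  · rw [← ModuleCat.comp_apply, ← singularCohomology.map_comp, hf]; rfl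
  · rw [← ModuleCat.comp_apply, ← singularCohomology.map_comp, hg]; rfl

/-! ### The additivity theorem -/

/-- **Additivity of the signature from two collapse maps** (Kervaire–Milnor 1963, §2 p. 508,
`σ(W₁ ♮ W₂) = σ(W₁) + σ(W₂)`, cohomological mechanism): let `X_U`, `X_S`, `X_T` be `ℤ`-oriented
in formal dimension `n = k + k`, `k` even, `π_S : X_U → X_S`, `π_T : X_U → X_T` carrying `[X_U]`
to `[X_S]`, `[X_T]`; let `X_U = U ∪ V` be an open cover with `(π_S ∘ incl_U)^* = 0`,
`(π_T ∘ incl_V)^* = 0` (no cross terms), and `A`, `B ⊆ X_U` with `(π_T ∘ incl_A)^* = 0`,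
`(π_S ∘ incl_B)^* = 0`, `(π_S ∘ incl_A)^*`, `(π_T ∘ incl_B)^*` bijective on `Hᵏ`, and the two
restrictions `Hᵏ(X_U) → Hᵏ(A)`, `Hᵏ(B)` jointly injective; all `Hᵏ/T` finitely generated. Then
`σ(X_U) = σ(X_S) + σ(X_T)`. [cite: KervaireMilnorAnnals1963, §2 p. 508] -/
theorem HomologicalOrientation.signatureInDim_eq_add_of_collapse
    {XU XS XT : Type u} [TopologicalSpace XU] [TopologicalSpace XS] [TopologicalSpace XT]
    {k n : ℕ} (h : k + k = n) (hk : Even k)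
    (μU : HomologicalOrientation ℤ XU n) (μS : HomologicalOrientation ℤ XS n)
    (μT : HomologicalOrientation ℤ XT n) (πS : C(XU, XS)) (πT : C(XU, XT))
    (hfcS : singularHomology.map ℤ ℤ πS n μU.fundamentalClass = μS.fundamentalClass)
    (hfcT : singularHomology.map ℤ ℤ πT n μU.fundamentalClass = μT.fundamentalClass)
    {U V : Set XU} (hU : IsOpen U) (hV : IsOpen V) (hUV : U ∪ V = univ)
    (hSU : singularCohomology.map ℤ ℤ (πS.comp (subsetIncl U)) k = 0)
    (hTV : singularCohomology.map ℤ ℤ (πT.comp (subsetIncl V)) k = 0)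
    {A B : Set XU}
    (hinj : ∀ c : singularCohomology ℤ ℤ XU k,
      singularCohomology.map ℤ ℤ (subsetIncl A) k c = 0 →
        singularCohomology.map ℤ ℤ (subsetIncl B) k c = 0 → c = 0)
    (hSA : Bijective (singularCohomology.map ℤ ℤ (πS.comp (subsetIncl A)) k))
    (hTB : Bijective (singularCohomology.map ℤ ℤ (πT.comp (subsetIncl B)) k))
    (hTA : singularCohomology.map ℤ ℤ (πT.comp (subsetIncl A)) k = 0)
    (hSB : singularCohomology.map ℤ ℤ (πS.comp (subsetIncl B)) k = 0)
    [Module.Finite ℤ (freeCohomology ℤ XU k)] [Module.Finite ℤ (freeCohomology ℤ XS k)]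
    [Module.Finite ℤ (freeCohomology ℤ XT k)] :
    μU.signatureInDim h = μS.signatureInDim h + μT.signatureInDim h := by
  rw [HomologicalOrientation.signatureInDim_def, HomologicalOrientation.signatureInDim_def,
    HomologicalOrientation.signatureInDim_def]
  refine LinearMap.BilinForm.signature_eq_add_of_embeddings (intersectionForm h μU)
    (intersectionForm h μS) (intersectionForm h μT)
    (isSymm_intersectionForm (cupProduct_gradedComm_holds ℤ XS) hk h μS)
    (isSymm_intersectionForm (cupProduct_gradedComm_holds ℤ XT) hk h μT)
    (freeCohomology.map πS k) (freeCohomology.map πT k)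
    (freeCohomology.map (subsetIncl A) k) (freeCohomology.map (subsetIncl B) k)
    (freeCohomology.eq_zero_of_map_eq_zero₂ (subsetIncl A) (subsetIncl B) k hinj)
    ?_ ?_ ?_ ?_ ?_ ?_ ?_ ?_
  · rw [← freeCohomology.map_comp]
    exact freeCohomology.map_bijective_of_bijective _ k hSA
  · rw [← freeCohomology.map_comp]
    exact freeCohomology.map_bijective_of_bijective _ k hTB
  · rw [← freeCohomology.map_comp]
    ext x
    induction x using freeCohomology.induction_on with
    | h a => rw [freeCohomology.map_mk, hTA]; rfl
  · rw [← freeCohomology.map_comp]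
    ext x
    induction x using freeCohomology.induction_on with
    | h a => rw [freeCohomology.map_mk, hSB]; rfl
  · intro x y
    induction x using freeCohomology.induction_on with
    | h a =>
      induction y using freeCohomology.induction_on with
      | h a' =>
        rw [freeCohomology.map_mk, freeCohomology.map_mk, intersectionForm_mk_mk,
          intersectionForm_mk_mk, cupPairing_apply, cupPairing_apply, ← cupProduct_map,
          kroneckerPairing_map, hfcS]
  · intro x y
    induction x using freeCohomology.induction_on with
    | h b =>
      induction y using freeCohomology.induction_on with
      | h b' =>
        rw [freeCohomology.map_mk, freeCohomology.map_mk, intersectionForm_mk_mk,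
          intersectionForm_mk_mk, cupPairing_apply, cupPairing_apply, ← cupProduct_map,
          kroneckerPairing_map, hfcT]
  · intro x y
    induction x using freeCohomology.induction_on with
    | h a =>
      induction y using freeCohomology.induction_on with
      | h b =>
        rw [freeCohomology.map_mk, freeCohomology.map_mk, intersectionForm_mk_mk, cupPairing_apply,
          cupProduct_map_map_eq_zero hU hV hUV h πS πT hSU hTV, map_zero, LinearMap.zero_apply]
  · intro x y
    induction x using freeCohomology.induction_on with
    | h b =>
      induction y using freeCohomology.induction_on with
      | h a =>
        rw [freeCohomology.map_mk, freeCohomology.map_mk, intersectionForm_mk_mk, cupPairing_apply,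
          cupProduct_map_map_eq_zero hV hU (by rw [union_comm, hUV]) h πT πS hTV hSU, map_zero,
          LinearMap.zero_apply]

end Literature.AlgebraicTopology.SingularHomology
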